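import Mathlib
import Literature.NumberTheory.Irrationality.CressonFischlerRivoal2008.WellPoisedSymmetry
import HarnessLib

/-!
# Lai's block summand: the reflection law `R̃_n(−t − Mn) = −(−1)^{J(Mn+1)} R̃_n(t)` (exact, all parameters)

HONEST FRAMING: systematic search; no irrationality claim unless certified.  Cell `pub-zeta5`, lane
`families/indep` (FAMILY.md v2 §5.10, the κ₃-ladder canary).  This file proves an EXACT algebraic law and
nothing asymptotic or arithmetic.

Lai [arXiv:2407.14236, §13 p.47 and (3.1)] builds linear forms in zeta values from the rational function
`R̃_n(t) = C_n · (2t + Mn) (t − rn)_{rn} (t + Mn + 1)_{rn} / ∏_{j=1}^{J} (t + δ_j n)_{(M − 2δ_j)n + 1}`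
(`C_n = ∏_j ((M − 2δ_j)n)! / n!^{2r}` a non-zero constant in `t`, omitted below since it does not affect a
reflection law), with integers `r, M ≥ 0` and block shifts `0 ≤ δ_j ≤ M/2`.  The symmetry that removes the EVEN
zeta values from `Σ_{t ≥ 1} R̃_n(t)` is the well-poised antisymmetry `R̃_n(−t − Mn) = −R̃_n(t)`
(Ball–Rivoal; Cresson–Fischler–Rivoal 2008 Théorème 1 — tree theorem
`Literature.NumberTheory.Irrationality.CressonFischlerRivoal2008.theoreme1_holds` — turns it, together with
`deg R̃_n ≤ −2`, into "the sum lies in `ℚ + Σ_{3 ≤ s ≤ J, s odd} ℚ ζ(s)`").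

Main results (all parameters, every `t : ℚ`, Lean's `x / 0 = 0` convention making the poles harmless):
* `laiNum_reflect` : the numerator is ODD under `t ↦ −t − Mn`;
* `laiBlock_reflect` : one block picks up the sign `(−1)^{(M−2δ_j)n + 1}` (needs `2δ_j ≤ M`);
* `laiCore_reflect` : `R̃(−t − Mn) = −(∏_j (−1)^{(M−2δ_j)n+1}) · R̃(t)`;
* `laiCore_reflect_even` : for EVEN `J` the sign is `−1` for every `n` and `M` — the case used in FAMILY.md
  §5.10 (J = 76, 74, 72: forms in `1, ζ(3), …, ζ(J−1)`);
* `laiCore_reflect_odd` : for ODD `J` the sign is `(−1)^{Mn}`, i.e. the antisymmetry holds exactly when `Mn`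
  is odd (so an odd number of unit blocks is admissible only along odd `n` with `M` odd, and then CFR allows
  `ζ(J)` itself: no gain over `J + 1` blocks — the remark of FAMILY.md §5.10);
* `laiBox_hasSum_oddZeta` (section CFR) : for EVEN `J ≥ 1`, `2δ_j ≤ M` and the degree condition,
  `Σ_{k≥0} R̃_n(k+1)` converges to `a₀ + Σ_{3≤s≤J, s odd} a_s ζ(s)`, `a_s ∈ ℚ` — PROVED from the tree theorem
  `CressonFischlerRivoal2008.theoreme1_holds` by packaging `R̃_n = P/(t)_{Mn+1}^J`, `P ∈ ℚ[X]`
  (`laiPoly`, `laiPoly_eval`, `laiPoly_natDegree_le`, `laiPoly_symm`, `poch_split`).  This is the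
  hypothesis-free "forms in `1, ζ(3), ζ(5), …, ζ(J−1)`" half of any certificate built on Lai's box
  (the arithmetic and asymptotic halves stay MODEL-LEVEL, FAMILY.md §5.10).
-/

namespace Summit.KontsevichZagierPeriods.Zeta5Search

open Finset

/-- Product of negated factors over `range m`: `∏ (−f i) = (−1)^m ∏ f i`. [folklore] -/
theorem prod_range_neg {R : Type*} [CommRing R] (m : ℕ) (f : ℕ → R) :
    ∏ i ∈ range m, (-(f i)) = (-1) ^ m * ∏ i ∈ range m, f i := by
  have h : ∀ i ∈ range m, (-(f i)) = (-1) * f i := fun i _ => by ring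
  rw [prod_congr rfl h, prod_mul_distrib, prod_const, card_range]

/-- Reflection of an arithmetic-progression product: `∏_{i ≤ L} (a + (L − i)) = ∏_{i ≤ L} (a + i)`. [folklore] -/
theorem prod_range_succ_reflect_add {R : Type*} [CommRing R] (a : R) (L : ℕ) :
    ∏ i ∈ range (L + 1), (a + ((L - i : ℕ) : R)) = ∏ i ∈ range (L + 1), (a + (i : R)) := by
  have := prod_range_reflect (fun i => a + (i : R)) (L + 1)
  simpa using this

/-- Numerator of Lai's unit-block summand (without the constant `C_n`):
`(2t + Mn) · ∏_{i=1}^{rn} (t − i) · ∏_{i=1}^{rn} (t + Mn + i)`. [cite: Lai2024BallRivoal, §13 (display for R̃_n), (3.1)] -/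
def laiNum (r M n : ℕ) (t : ℚ) : ℚ :=
  (2 * t + (M : ℚ) * n) * (∏ i ∈ range (r * n), (t - ((i : ℚ) + 1))) *
    ∏ i ∈ range (r * n), (t + (M : ℚ) * n + ((i : ℚ) + 1))

/-- One denominator block `(t + δn)_{(M−2δ)n+1} = ∏_{i=0}^{(M−2δ)n} (t + δn + i)`. [cite: Lai2024BallRivoal, (3.1)] -/
def laiBlock (M δ n : ℕ) (t : ℚ) : ℚ :=
  ∏ i ∈ range ((M - 2 * δ) * n + 1), (t + (δ : ℚ) * n + (i : ℚ))

/-- The full denominator `∏_j (t + δ_j n)_{(M−2δ_j)n+1}` for block shifts `δ : Fin J → ℕ`. [cite: Lai2024BallRivoal, (3.1)] -/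
def laiDen (J M n : ℕ) (δ : Fin J → ℕ) (t : ℚ) : ℚ :=
  ∏ j, laiBlock M (δ j) n t

/-- Lai's unit-block summand up to the constant `C_n`: `laiNum / laiDen`. [cite: Lai2024BallRivoal, §13] -/
def laiCore (J r M n : ℕ) (δ : Fin J → ℕ) (t : ℚ) : ℚ :=
  laiNum r M n t / laiDen J M n δ t

/-- The numerator is odd under the reflection `t ↦ −t − Mn` (the two Pochhammer strings swap). [this file] -/
theorem laiNum_reflect (r M n : ℕ) (t : ℚ) :
    laiNum r M n (-t - (M : ℚ) * n) = -laiNum r M n t := by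
  unfold laiNum
  have h1 : ∏ i ∈ range (r * n), (-t - (M : ℚ) * n - ((i : ℚ) + 1)) =
      ∏ i ∈ range (r * n), (-(t + (M : ℚ) * n + ((i : ℚ) + 1))) :=
    prod_congr rfl (fun i _ => by ring)
  have h2 : ∏ i ∈ range (r * n), (-t - (M : ℚ) * n + (M : ℚ) * n + ((i : ℚ) + 1)) =
      ∏ i ∈ range (r * n), (-(t - ((i : ℚ) + 1))) :=
    prod_congr rfl (fun i _ => by ring)
  rw [h1, h2, prod_range_neg, prod_range_neg]
  have hs : ((-1 : ℚ) ^ (r * n)) * ((-1 : ℚ) ^ (r * n)) = 1 := by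
    rw [← mul_pow]; norm_num
  linear_combination (-((2 * t + (M : ℚ) * n) * (∏ i ∈ range (r * n), (t - ((i : ℚ) + 1))) *
    ∏ i ∈ range (r * n), (t + (M : ℚ) * n + ((i : ℚ) + 1)))) * hs

/-- One block reflects with the sign `(−1)^{(M−2δ)n+1}` when `2δ ≤ M`. [this file] -/
theorem laiBlock_reflect (M δ n : ℕ) (hδ : 2 * δ ≤ M) (t : ℚ) :
    laiBlock M δ n (-t - (M : ℚ) * n) = (-1) ^ ((M - 2 * δ) * n + 1) * laiBlock M δ n t := by
  unfold laiBlock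
  set L := (M - 2 * δ) * n with hL
  have hLq : (L : ℚ) = ((M : ℚ) - 2 * δ) * n := by
    rw [hL]; push_cast [Nat.cast_sub hδ]; ring
  have h1 : ∀ i ∈ range (L + 1),
      (-t - (M : ℚ) * n + (δ : ℚ) * n + (i : ℚ)) = -(t + (δ : ℚ) * n + ((L - i : ℕ) : ℚ)) := by
    intro i hi
    have hi' : i ≤ L := Nat.lt_succ_iff.mp (mem_range.mp hi)
    rw [Nat.cast_sub hi', hLq]; ring
  rw [prod_congr rfl h1, prod_range_neg, prod_range_succ_reflect_add]

/-- The denominator reflects with the product of the block signs. [this file] -/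
theorem laiDen_reflect (J M n : ℕ) (δ : Fin J → ℕ) (hδ : ∀ j, 2 * δ j ≤ M) (t : ℚ) :
    laiDen J M n δ (-t - (M : ℚ) * n) =
      (∏ j, (-1 : ℚ) ^ ((M - 2 * δ j) * n + 1)) * laiDen J M n δ t := by
  unfold laiDen
  rw [← prod_mul_distrib]
  exact prod_congr rfl (fun j _ => laiBlock_reflect M (δ j) n (hδ j) t)

/-- **Reflection law** for Lai's unit-block summand, all parameters with `2δ_j ≤ M`:
`R̃(−t − Mn) = −(∏_j (−1)^{(M−2δ_j)n+1}) · R̃(t)` for every rational `t` (poles included, by `x/0 = 0`). [this file] -/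
theorem laiCore_reflect (J r M n : ℕ) (δ : Fin J → ℕ) (hδ : ∀ j, 2 * δ j ≤ M) (t : ℚ) :
    laiCore J r M n δ (-t - (M : ℚ) * n) =
      -(∏ j, (-1 : ℚ) ^ ((M - 2 * δ j) * n + 1)) * laiCore J r M n δ t := by
  unfold laiCore
  set S : ℚ := ∏ j, (-1 : ℚ) ^ ((M - 2 * δ j) * n + 1) with hS
  have hSS : S * S = 1 := by
    rw [hS, ← prod_mul_distrib, prod_eq_one]
    intro j _
    rw [← mul_pow]; norm_num
  have hSinv : S⁻¹ = S := inv_eq_of_mul_eq_one_right hSS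
  rw [laiNum_reflect, laiDen_reflect J M n δ hδ, div_mul_eq_div_div_swap, div_eq_mul_inv _ S, hSinv]
  ring

/-- Parity of a block sign: `(−1)^{(M−2δ)n+1} = (−1)^{Mn+1}` when `2δ ≤ M`. [this file] -/
theorem blockSign_eq (M δ n : ℕ) (hδ : 2 * δ ≤ M) :
    (-1 : ℚ) ^ ((M - 2 * δ) * n + 1) = (-1) ^ (M * n + 1) := by
  rw [neg_one_pow_eq_pow_mod_two (R := ℚ), neg_one_pow_eq_pow_mod_two (R := ℚ) (n := M * n + 1)]
  congr 1
  have h2 : 2 * δ * n ≤ M * n := Nat.mul_le_mul_right n hδ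
  rw [Nat.sub_mul]
  generalize M * n = x at h2 ⊢
  generalize hy : 2 * δ * n = y at h2 ⊢
  have hy2 : y % 2 = 0 := by rw [← hy]; simp [Nat.mul_assoc]
  omega

/-- **Even number of blocks**: `R̃(−t − Mn) = −R̃(t)` for every `n`, `M` — the well-poised antisymmetry
that (with `deg ≤ −2`, via CFR Théorème 1) confines `Σ_t R̃_n(t)` to `ℚ + Σ_{odd s ≤ J−1} ℚ ζ(s)`. [this file] -/
theorem laiCore_reflect_even (J r M n : ℕ) (δ : Fin J → ℕ) (hδ : ∀ j, 2 * δ j ≤ M) (hJ : Even J)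
    (t : ℚ) : laiCore J r M n δ (-t - (M : ℚ) * n) = -laiCore J r M n δ t := by
  rw [laiCore_reflect J r M n δ hδ t]
  have hS : (∏ j, (-1 : ℚ) ^ ((M - 2 * δ j) * n + 1)) = 1 := by
    rw [prod_congr rfl (fun j _ => blockSign_eq M (δ j) n (hδ j)), prod_const, Finset.card_univ,
      Fintype.card_fin, ← pow_mul]
    exact Even.neg_one_pow (hJ.mul_left _)
  rw [hS]; ring

/-- **Odd number of blocks**: the sign is `(−1)^{Mn}`, so the antisymmetry holds iff `Mn` is odd. [this file] -/
theorem laiCore_reflect_odd (J r M n : ℕ) (δ : Fin J → ℕ) (hδ : ∀ j, 2 * δ j ≤ M) (hJ : Odd J)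
    (t : ℚ) : laiCore J r M n δ (-t - (M : ℚ) * n) = (-1) ^ (M * n) * laiCore J r M n δ t := by
  rw [laiCore_reflect J r M n δ hδ t]
  have hS : (∏ j, (-1 : ℚ) ^ ((M - 2 * δ j) * n + 1)) = (-1) ^ (M * n + 1) := by
    rw [prod_congr rfl (fun j _ => blockSign_eq M (δ j) n (hδ j)), prod_const, Finset.card_univ,
      Fintype.card_fin, ← pow_mul]
    obtain ⟨k, hk⟩ := hJ
    rw [hk, Nat.mul_add, Nat.mul_one, pow_add, pow_mul]
    have : ((-1 : ℚ) ^ (M * n + 1)) ^ (2 * k) = 1 := by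
      rw [← pow_mul, show (M * n + 1) * (2 * k) = 2 * ((M * n + 1) * k) by ring, pow_mul]
      norm_num
    rw [this, one_mul]
  rw [hS, pow_succ]; ring

/-! ## Hook-up with Cresson–Fischler–Rivoal, Théorème 1 (tree theorem `theoreme1_holds`)

For EVEN `J`, `2δ_j ≤ M` and Lai's degree condition `deg R̃_n ≤ −2` (here: the explicit inequality
`hdeg`), the series `Σ_{k ≥ 0} R̃_n(k+1)` (without the constant `C_n`) converges to a `ℚ`-linear combination
of `1` and the ODD zeta values `ζ(s)`, `3 ≤ s ≤ J − 1` (CFR allow `s ≤ J`; `J` even).  The normal form for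
CFR is `R̃_n(t) = P(t)/(t)_{Mn+1}^J` with `P = laiNum · ∏_j c_j ∈ ℚ[X]`,
`c_j(t) = (t)_{Mn+1}/(t + δ_j n)_{(M−2δ_j)n+1} = ∏_{i<δ_j n}(t+i) · ∏_{i<δ_j n}(t + (M−δ_j)n + 1 + i)`. -/

section CFR

open Polynomial Literature.NumberTheory.Irrationality.CressonFischlerRivoal2008
open Literature.NumberTheory.Transcendental (zetaValue)

variable {J r M n : ℕ} {δ : Fin J → ℕ}

/-- The side factor `c_j(t) = ∏_{i<δn}(t+i) · ∏_{i<δn}(t + ((M−δ)n + 1) + i)` completing one unit block to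
the full Pochhammer `(t)_{Mn+1}`. [this file] -/
def laiCof (M δ n : ℕ) (t : ℚ) : ℚ :=
  (∏ i ∈ range (δ * n), (t + (i : ℚ))) *
    ∏ i ∈ range (δ * n), (t + (((M : ℚ) - δ) * n + 1) + (i : ℚ))

/-- CFR normal-form numerator `P = laiNum · ∏_j c_j` as an element of `ℚ[X]`. [this file] -/
noncomputable def laiPoly (J r M n : ℕ) (δ : Fin J → ℕ) : ℚ[X] :=
  (C 2 * X + C ((M : ℚ) * n)) * (∏ i ∈ range (r * n), (X - C ((i : ℚ) + 1))) *
    (∏ i ∈ range (r * n), (X + C ((M : ℚ) * n) + C ((i : ℚ) + 1))) *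
    ∏ j, ((∏ i ∈ range (δ j * n), (X + C (i : ℚ))) *
      ∏ i ∈ range (δ j * n), (X + C (((M : ℚ) - δ j) * n + 1) + C (i : ℚ)))

/-- `P(t) = laiNum(t) · ∏_j c_j(t)`. [this file] -/
theorem laiPoly_eval (t : ℚ) :
    (laiPoly J r M n δ).eval t = laiNum r M n t * ∏ j, laiCof M (δ j) n t := by
  simp [laiPoly, laiNum, laiCof, eval_prod]

/-- A product of polynomials of degree `≤ 1` over `s` has degree `≤ #s`. [folklore] -/
theorem natDegree_prod_le_card {ι : Type*} (s : Finset ι) (f : ι → ℚ[X])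
    (h : ∀ i, (f i).natDegree ≤ 1) : (∏ i ∈ s, f i).natDegree ≤ s.card :=
  (natDegree_prod_le s f).trans (by simpa using Finset.sum_le_sum (fun i (_ : i ∈ s) => h i))

/-- `deg P ≤ 1 + 2rn + Σ_j 2δ_j n`. [this file] -/
theorem laiPoly_natDegree_le :
    (laiPoly J r M n δ).natDegree ≤ 1 + 2 * (r * n) + ∑ j, 2 * (δ j * n) := by
  unfold laiPoly
  have h0 : (C (2 : ℚ) * X + C ((M : ℚ) * n)).natDegree ≤ 1 := natDegree_linear_le
  have hA : (∏ i ∈ range (r * n), (X - C ((i : ℚ) + 1))).natDegree ≤ r * n := by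
    simpa using natDegree_prod_le_card (range (r * n)) (fun i : ℕ => X - C ((i : ℚ) + 1))
      (fun i => by rw [natDegree_X_sub_C])
  have hB : (∏ i ∈ range (r * n), (X + C ((M : ℚ) * n) + C ((i : ℚ) + 1))).natDegree ≤ r * n := by
    simpa using natDegree_prod_le_card (range (r * n))
      (fun i : ℕ => X + C ((M : ℚ) * n) + C ((i : ℚ) + 1))
      (fun i => by rw [add_assoc, ← C_add, natDegree_X_add_C])
  have hC : ∀ j, ((∏ i ∈ range (δ j * n), (X + C (i : ℚ))) *
      ∏ i ∈ range (δ j * n), (X + C (((M : ℚ) - δ j) * n + 1) + C (i : ℚ))).natDegree ≤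
      2 * (δ j * n) := by
    intro j
    refine (natDegree_mul_le).trans ?_
    have h1 : (∏ i ∈ range (δ j * n), (X + C (i : ℚ))).natDegree ≤ δ j * n := by
      simpa using natDegree_prod_le_card (range (δ j * n)) (fun i : ℕ => X + C (i : ℚ))
        (fun i => by rw [natDegree_X_add_C])
    have h2 : (∏ i ∈ range (δ j * n), (X + C (((M : ℚ) - δ j) * n + 1) + C (i : ℚ))).natDegree ≤
        δ j * n := by
      simpa using natDegree_prod_le_card (range (δ j * n))
        (fun i : ℕ => X + C (((M : ℚ) - δ j) * n + 1) + C (i : ℚ))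
        (fun i => by rw [add_assoc, ← C_add, natDegree_X_add_C])
    omega
  have hD : (∏ j, ((∏ i ∈ range (δ j * n), (X + C (i : ℚ))) *
      ∏ i ∈ range (δ j * n), (X + C (((M : ℚ) - δ j) * n + 1) + C (i : ℚ)))).natDegree ≤
      ∑ j, 2 * (δ j * n) :=
    (natDegree_prod_le _ _).trans (Finset.sum_le_sum (fun j _ => hC j))
  have := natDegree_mul_le.trans (Nat.add_le_add
    (natDegree_mul_le.trans (Nat.add_le_add (natDegree_mul_le.trans (Nat.add_le_add h0 hA)) hB)) hD)
  omega

/-- The side factor is EVEN under the reflection (its two strings swap). [this file] -/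
theorem laiCof_reflect (M δ n : ℕ) (t : ℚ) :
    laiCof M δ n (-t - (M : ℚ) * n) = laiCof M δ n t := by
  unfold laiCof
  set d := δ * n with hd
  have hc : ((M : ℚ) - δ) * n + d = (M : ℚ) * n := by rw [hd]; push_cast; ring
  have hA : ∏ i ∈ range d, (-t - (M : ℚ) * n + (i : ℚ)) =
      (-1) ^ d * ∏ i ∈ range d, (t + (((M : ℚ) - δ) * n + 1) + (i : ℚ)) := by
    have h1 : ∀ i ∈ range d, (-t - (M : ℚ) * n + (i : ℚ)) =
        -(t + (((M : ℚ) - δ) * n + 1) + ((d - 1 - i : ℕ) : ℚ)) := by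
      intro i hi
      have hi' : i < d := mem_range.mp hi
      have e : ((d - 1 - i : ℕ) : ℚ) = (d : ℚ) - 1 - i := by
        rw [Nat.sub_sub, Nat.cast_sub (by omega)]; push_cast; ring
      rw [e]; linear_combination hc
    rw [prod_congr rfl h1, prod_range_neg]
    congr 1
    exact prod_range_reflect (fun i => t + (((M : ℚ) - δ) * n + 1) + (i : ℚ)) d
  have hB : ∏ i ∈ range d, (-t - (M : ℚ) * n + (((M : ℚ) - δ) * n + 1) + (i : ℚ)) =
      (-1) ^ d * ∏ i ∈ range d, (t + (i : ℚ)) := by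
    have h2 : ∀ i ∈ range d, (-t - (M : ℚ) * n + (((M : ℚ) - δ) * n + 1) + (i : ℚ)) =
        -(t + ((d - 1 - i : ℕ) : ℚ)) := by
      intro i hi
      have hi' : i < d := mem_range.mp hi
      have e : ((d - 1 - i : ℕ) : ℚ) = (d : ℚ) - 1 - i := by
        rw [Nat.sub_sub, Nat.cast_sub (by omega)]; push_cast; ring
      rw [e]; linear_combination hc
    rw [prod_congr rfl h2, prod_range_neg]
    congr 1
    exact prod_range_reflect (fun i => t + (i : ℚ)) d
  rw [hA, hB, mul_mul_mul_comm, ← mul_pow]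
  norm_num [mul_comm]

/-- **Well-poised symmetry of the normal-form numerator**, CFR shape: for even `J` (no condition on the
shifts is needed for the polynomial identity), `P(−Mn − X) = (−1)^{J(Mn+1)+1} P(X)`. [this file] -/
theorem laiPoly_symm (hJ : Even J) :
    (laiPoly J r M n δ).comp (-((M * n : ℕ) : ℚ[X]) - X) =
      (-1 : ℚ[X]) ^ (J * (M * n + 1) + 1) * laiPoly J r M n δ := by
  have hsign : (-1 : ℚ[X]) ^ (J * (M * n + 1) + 1) = -1 := by
    rw [pow_succ, (hJ.mul_right _).neg_one_pow]; ring
  rw [hsign]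
  apply Polynomial.funext
  intro t
  rw [eval_comp]
  simp only [eval_sub, eval_neg, eval_X, eval_natCast, eval_mul, eval_one, laiPoly_eval]
  have ht : (-((M * n : ℕ) : ℚ) - t) = -t - (M : ℚ) * n := by push_cast; ring
  rw [ht, laiNum_reflect,
    prod_congr rfl (fun j _ => laiCof_reflect M (δ j) n t)]
  ring

/-- Splitting the full Pochhammer: `(t)_{Mn+1} = c(t) · (t + δn)_{(M−2δ)n+1}`. [this file] -/
theorem poch_split (M δ n : ℕ) (hδ : 2 * δ ≤ M) (t : ℚ) :
    ∏ i ∈ range (M * n + 1), (t + (i : ℚ)) = laiCof M δ n t * laiBlock M δ n t := by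
  have hsplit : M * n + 1 = δ * n + ((M - 2 * δ) * n + 1) + δ * n := by
    zify [hδ]; ring
  rw [hsplit, prod_range_add, prod_range_add]
  have p2 : ∏ x ∈ range ((M - 2 * δ) * n + 1), (t + ((δ * n + x : ℕ) : ℚ)) = laiBlock M δ n t := by
    unfold laiBlock; exact prod_congr rfl (fun x _ => by push_cast; ring)
  have p3 : ∏ x ∈ range (δ * n), (t + ((δ * n + ((M - 2 * δ) * n + 1) + x : ℕ) : ℚ)) =
      ∏ i ∈ range (δ * n), (t + (((M : ℚ) - δ) * n + 1) + (i : ℚ)) :=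
    prod_congr rfl (fun x _ => by push_cast [Nat.cast_sub hδ]; ring)
  rw [p2, p3]; unfold laiCof; ring

/-- The side factor is positive at positive arguments (so it can be cancelled). [this file] -/
theorem laiCof_pos (M δ n : ℕ) (hδ : δ ≤ M) (t : ℚ) (ht : 0 < t) : 0 < laiCof M δ n t := by
  unfold laiCof
  have hM : (0 : ℚ) ≤ ((M : ℚ) - δ) * n :=
    mul_nonneg (sub_nonneg.mpr (by exact_mod_cast hδ)) (Nat.cast_nonneg n)
  refine mul_pos (prod_pos fun i _ => ?_) (prod_pos fun i _ => ?_)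
  · have := Nat.cast_nonneg (α := ℚ) i; linarith
  · have := Nat.cast_nonneg (α := ℚ) i; linarith

/-- **Lai-box forms lie in `ℚ + Σ_{odd s} ℚ ζ(s)`** (hypothesis-free; CFR Théorème 1 via the tree theorem
`theoreme1_holds`): for an EVEN number `J ≥ 1` of unit blocks with `2δ_j ≤ M` and the degree condition,
`Σ_{k ≥ 0} R̃_n(k+1) = a₀ + Σ_{3 ≤ s ≤ J, s odd} a_s ζ(s)` with `a_s ∈ ℚ` (for even `J` the top value is `ζ(J−1)`).
The constant prefactor `C_n` of Lai's `R̃_n` only rescales the `a_s`. [this file] -/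
theorem laiBox_hasSum_oddZeta (J r M n : ℕ) (δ : Fin J → ℕ) (hJ : Even J) (hJ1 : 1 ≤ J)
    (hδ : ∀ j, 2 * δ j ≤ M) (hdeg : 1 + 2 * (r * n) + (∑ j, 2 * (δ j * n)) + 2 ≤ J * (M * n + 1)) :
    ∃ a : ℕ → ℚ, HasSum (fun k : ℕ => ((laiCore J r M n δ ((k : ℚ) + 1) : ℚ) : ℝ))
      ((a 0 : ℝ) + ∑ s ∈ (Finset.Icc 3 J).filter Odd, (a s : ℝ) * zetaValue s) := by
  obtain ⟨a, ha⟩ := theoreme1_holds (M * n) J (laiPoly J r M n δ) hJ1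
    ((Nat.add_le_add_right laiPoly_natDegree_le 2).trans hdeg) (laiPoly_symm hJ)
  have hterm : ∀ k : ℕ, (aeval ((k : ℝ) + 1) (laiPoly J r M n δ)) / poch (k + 1) (M * n) ^ J =
      ((laiCore J r M n δ ((k : ℚ) + 1) : ℚ) : ℝ) := by
    intro k
    have e1 : aeval ((k : ℝ) + 1) (laiPoly J r M n δ) =
        (((laiPoly J r M n δ).eval ((k : ℚ) + 1) : ℚ) : ℝ) := by
      have : ((k : ℝ) + 1) = algebraMap ℚ ℝ ((k : ℚ) + 1) := by rw [eq_ratCast]; push_cast; rfl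
      rw [this, aeval_algebraMap_apply_eq_algebraMap_eval, eq_ratCast]
    have e2 : poch (k + 1) (M * n) = ((∏ i ∈ range (M * n + 1), (((k : ℚ) + 1) + (i : ℚ)) : ℚ) : ℝ) := by
      unfold poch; push_cast; rfl
    have hC : (∏ j, laiCof M (δ j) n ((k : ℚ) + 1)) ≠ 0 :=
      (prod_pos fun j _ => laiCof_pos M (δ j) n (by have := hδ j; omega) _ (by positivity)).ne'
    have e3 : (∏ i ∈ range (M * n + 1), (((k : ℚ) + 1) + (i : ℚ))) ^ J =
        laiDen J M n δ ((k : ℚ) + 1) * ∏ j, laiCof M (δ j) n ((k : ℚ) + 1) := by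
      rw [laiDen, ← prod_mul_distrib]
      have hc : (∏ _j : Fin J, ∏ i ∈ range (M * n + 1), (((k : ℚ) + 1) + (i : ℚ))) =
          (∏ i ∈ range (M * n + 1), (((k : ℚ) + 1) + (i : ℚ))) ^ J := by
        rw [prod_const, Finset.card_univ, Fintype.card_fin]
      rw [← hc]
      exact prod_congr rfl (fun j _ => by rw [poch_split M (δ j) n (hδ j), mul_comm])
    rw [e1, e2, ← Rat.cast_pow, ← Rat.cast_div, e3, laiPoly_eval, laiCore, mul_div_mul_right _ _ hC]
  exact ⟨a, by simpa only [hterm] using ha⟩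

end CFR

end Summit.KontsevichZagierPeriods.Zeta5Search
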